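import Summits.QuantumFields.YangMills.Theorems.PoincareLipschitzConeLinkWeakDeriv
import Summits.QuantumFields.YangMills.Theorems.PoincareLipschitzConeLinkEnergy
import Summits.QuantumFields.YangMills.Theorems.PoincareLipschitzConeLinkCurrents
import Summits.QuantumFields.YangMills.Theorems.PoincareLipschitzMonotonicityEquality
import Summits.QuantumFields.YangMills.Theorems.PoincareLipschitzMinimiserWeaklyHarmonic
import Summits.QuantumFields.YangMills.Theorems.PoincareLipschitzMinimiserBallBridge
import HarnessLib

/-!
# Crux `BlockLipschitzL` (stmt-QuantumFields-23533) ∕ `HistoryTailL` (stmt-QuantumFields-19936), LINE 25 «CompactnessTransfer»,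
# stub S1″ — ROAD (H) «SU(2) currents ⇒ H-system ⇒ 8π quantum», brick (T) «CONE → PLANE TRANSPORT», THE DOOR

Cell `ym3-torus` (YM ladder rung R3 = continuum SU(2) Yang–Mills on T³ — a RUNG, NOT Clay: not d = 4, not infinite volume,
not a mass gap); WIDTH helper seat `ym3-torus-px14` g7, the (T) pen of px19 g8's ROAD (H) (memo `ROAD-TM-HSYSTEM-px19g8.md`,
architecture v1: the (GAP) socket of px3 g9, K-DOOR ✓`PoincareLipschitzGapOfHSystemQuantization`).  Helper `--supports
stmt-QuantumFields-23533`; THEOREMS ONLY (0 `def`, 0 `sorry`, default heartbeats).  THE COMPANY: chart letters A1–A3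
✓`PoincareLipschitzConeLinkChart{,Region,Integral}` and row (T-3′) ✓`PoincareLipschitzConeLinkEnergy` by px16 g10; row (T-4)
✓`PoincareLipschitzConeLinkCurrents` by px19 g8; dilation ✓`…ConeLinkDilation{Letters,}`, good slices ✓`…ConeLinkSlice`, cut-offs
✓`…ConeLinkCutoff`, push-forward fields ✓`…ConeLinkPushforward`, the link ✓`…ConeLinkGoodSlice`, row (T-1) ✓`…ConeLinkWeakDeriv`
by px14 g7; radial constancy ✓`PoincareLipschitzMonotonicityEquality.radialDeriv_ae_zero_of_ball_linear` by px3 g9; the sphere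
conservation laws ✓`PoincareLipschitzMinimiserWeaklyHarmonic.weaklyHarmonic_of_cubeMinimiser` by w7 g14; `closedBall_subset_unitCube`
✓`PoincareLipschitzMinimiserBallBridge` (px3).

WHAT THIS FILE PROVES — ★★★ `exists_link_of_linear_energies`, px19 g8's DOOR-T text `DOOR-T-text.px19g8.txt` (sha16 d75a11c77055d928)
VERBATIM AS ITS TYPE: for every map `U : Q → S³ ⊂ ℝ⁴` of the vended class (weak gradient `G` on the open unit cube `Q`, pointwise unit,
finite energy, energy minimising on closed balls inside `Q`) whose ball energies about the origin are LINEAR, `E(U; B_r(0)) = Θ·r` for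
`0 < r ≤ 1∕2` (a minimizing TANGENT MAP, [SchoenUhlenbeck1984] §1), there is a LINK `w : E² → S³` with weak gradient `Gw` ON THE WHOLE
PLANE such that (T-1) `HasWeakFDerivOn ⟨univ,_⟩ volume w Gw`, (T-2) `‖w y‖ = 1` everywhere, (T-3′) `Σ_k ‖Gw e_k‖²` is integrable with
integral `Θ` (the cone's density), and (T-4) the 2-d sphere conservation laws `∫ Σ_k ∂_kη (⟪p,w⟫⟪Gw e_k,q⟫ − ⟪q,w⟫⟪Gw e_k,p⟫) = 0`
hold for all orthonormal `p, q` and all `η ∈ C_c^∞(E²)`.  The link is `w = U ∘ (t₀ • σ)` for a good height `t₀ ∈ (0, 1∕4)` of the cone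
chart `(t,y) ↦ t • σ(y)` (`σ` = inverse stereographic projection), and `Gw = (G ∘ (t₀•σ)) ∘L (t₀ • Dσ)`.
Proof = the knit: px3's monotonicity-equality theorem gives radial constancy `G x (x) = 0` a.e. on `B_{1∕4}(0)`; the good-slice
theorem gives `t₀`, `w`, `Gw` with the slab identities; (T-2) is pointwise (`t₀•σ y ∈ B_{1∕4} ⊆ Q`); (T-3′) is px16's energy transport
at `E(B_{1∕4}) = Θ∕4`; (T-4) is px19's current transport fed with w7's laws on `B_{1∕2}(0)`; (T-1) is FILE D4 with `Ω = Q`, local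
integrability of `w` (bounded, a.e.-measurable) and of `Gw` (`‖Gw‖ ≤ 1 + Σ_k‖Gw e_k‖²`, integrable by (T-3′)).

HONEST SCOPE.  This is brick (T) of a ROAD: it proves no stub by itself; with (Q) ✓, (H) ✓, the named fact (F) [BrezisCoron1985, Lemma
A.1] and px19's K-DOOR it yields (GAP) and hence S1″∕`BlockLipschitzL` CONDITIONALLY on (F).  Nothing of (GAP)∕(TM) unconditionally,
K1, `MeanDeviationL`, `HistoryTailL` is proved here.  YM₃ on T³ is rung R3, not Clay; YM gap NOT proved; no summit statement is proved.

References: R. Schoen, K. Uhlenbeck, Invent. Math. 78 (1984) 89–100 [SchoenUhlenbeck1984] (§1, tangent maps and their links); L. Simon,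
Theorems on Regularity and Singularity of Energy Minimizing Maps (1996) [Simon1996] (§3.1); H. Brezis, J.-M. Coron, Arch. Rational
Mech. Anal. 89 (1985) 21–56 [BrezisCoron1985] (Appendix, Lemma A.1 — the consumer's named fact).
-/

set_option autoImplicit false

noncomputable section

open MeasureTheory Set Function Filter Topology Metric TopologicalSpace
open scoped RealInnerProductSpace BigOperators ContDiff

namespace Summit.QuantumFields.YangMills.Theorems.PoincareLipschitzConeLinkTransport

open Literature.Analysis.FunctionSpaces (HasWeakFDerivOn)
open Summit.QuantumFields.YangMills.Theorems.PoincareLipschitzConeLinkChart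
open Summit.QuantumFields.YangMills.Theorems.PoincareLipschitzConeLinkGoodSlice
open Summit.QuantumFields.YangMills.Theorems.PoincareLipschitzConeLinkWeakDeriv
open Summit.QuantumFields.YangMills.Theorems.PoincareLipschitzConeLinkEnergy
open Summit.QuantumFields.YangMills.Theorems.PoincareLipschitzConeLinkCurrents
open Summit.QuantumFields.YangMills.Theorems.PoincareLipschitzConeLinkPushforward (sum_apply_smul_single)
open Summit.QuantumFields.YangMills.Theorems.PoincareLipschitzMonotonicityEquality (radialDeriv_ae_zero_of_ball_linear)
open Summit.QuantumFields.YangMills.Theorems.PoincareLipschitzMinimiserWeaklyHarmonic (weaklyHarmonic_of_cubeMinimiser)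
open Summit.QuantumFields.YangMills.Theorems.PoincareLipschitzMinimiserBallBridge (closedBall_subset_unitCube)

/-! ## §1 Local integrability of the link and of its gradient -/

/-- **A bounded a.e.-strongly measurable function on `E²` is locally integrable.** [folklore] -/
theorem locallyIntegrable_of_norm_le {W : Type*} [NormedAddCommGroup W] {f : EuclideanSpace ℝ (Fin 2) → W}
    (hf : AEStronglyMeasurable f volume) {M : ℝ} (hM : ∀ y, ‖f y‖ ≤ M) : LocallyIntegrable f volume := by
  rw [← locallyIntegrableOn_univ, locallyIntegrableOn_iff isOpen_univ.isLocallyClosed]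
  intro k _ hk
  exact Measure.integrableOn_of_bounded hk.measure_lt_top.ne hf (Filter.Eventually.of_forall hM)

/-- **Operator norm vs the energy density**: `‖L‖ ≤ 1 + Σ_k ‖L e_k‖²` for `L : E² →L F`. [folklore] -/
theorem opNorm_le_one_add_sum_sq {W : Type*} [NormedAddCommGroup W] [NormedSpace ℝ W]
    (L : EuclideanSpace ℝ (Fin 2) →L[ℝ] W) :
    ‖L‖ ≤ 1 + ∑ k : Fin 2, ‖L (EuclideanSpace.single k (1:ℝ))‖ ^ 2 := by
  have h1 : ‖L‖ ≤ ∑ k : Fin 2, ‖L (EuclideanSpace.single k (1:ℝ))‖ := by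
    refine ContinuousLinearMap.opNorm_le_bound _ (Finset.sum_nonneg fun k _ => norm_nonneg _) fun v => ?_
    have hv : v = ∑ k : Fin 2, v k • EuclideanSpace.single k (1:ℝ) := by
      have h := (EuclideanSpace.basisFun (Fin 2) ℝ).sum_repr v
      simpa only [EuclideanSpace.basisFun_repr, EuclideanSpace.basisFun_apply] using h.symm
    calc ‖L v‖ = ‖∑ k : Fin 2, v k • L (EuclideanSpace.single k (1:ℝ))‖ := by
          conv_lhs => rw [hv]
          simp only [map_sum, map_smul]
      _ ≤ ∑ k : Fin 2, ‖v k • L (EuclideanSpace.single k (1:ℝ))‖ := norm_sum_le _ _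
      _ ≤ ∑ k : Fin 2, ‖L (EuclideanSpace.single k (1:ℝ))‖ * ‖v‖ := by
          refine Finset.sum_le_sum fun k _ => ?_
          rw [norm_smul, mul_comm]
          exact mul_le_mul_of_nonneg_left (by simpa using PiLp.norm_apply_le v k) (norm_nonneg _)
      _ = (∑ k : Fin 2, ‖L (EuclideanSpace.single k (1:ℝ))‖) * ‖v‖ := (Finset.sum_mul _ _ _).symm
  have h2 : ∀ k : Fin 2, ‖L (EuclideanSpace.single k (1:ℝ))‖ ≤ 1 / 2 + ‖L (EuclideanSpace.single k (1:ℝ))‖ ^ 2 := by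
    intro k
    nlinarith [sq_nonneg (‖L (EuclideanSpace.single k (1:ℝ))‖ - 1 / 2)]
  calc ‖L‖ ≤ ∑ k : Fin 2, ‖L (EuclideanSpace.single k (1:ℝ))‖ := h1
    _ ≤ ∑ k : Fin 2, (1 / 2 + ‖L (EuclideanSpace.single k (1:ℝ))‖ ^ 2) := Finset.sum_le_sum fun k _ => h2 k
    _ = 1 + ∑ k : Fin 2, ‖L (EuclideanSpace.single k (1:ℝ))‖ ^ 2 := by
        rw [Finset.sum_add_distrib, Finset.sum_const, Finset.card_univ, Fintype.card_fin]; norm_num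

/-- **Finite energy makes the gradient locally integrable.** [folklore] -/
theorem locallyIntegrable_of_energy {W : Type*} [NormedAddCommGroup W] [NormedSpace ℝ W]
    {Gw : EuclideanSpace ℝ (Fin 2) → (EuclideanSpace ℝ (Fin 2) →L[ℝ] W)} (hm : AEStronglyMeasurable Gw volume)
    (hE : Integrable (fun y => ∑ k : Fin 2, ‖Gw y (EuclideanSpace.single k (1:ℝ))‖ ^ 2) volume) :
    LocallyIntegrable Gw volume := by
  rw [← locallyIntegrableOn_univ, locallyIntegrableOn_iff isOpen_univ.isLocallyClosed]
  intro k _ hk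
  have hb : IntegrableOn (fun y => (1:ℝ) + ∑ k : Fin 2, ‖Gw y (EuclideanSpace.single k (1:ℝ))‖ ^ 2) k volume :=
    (integrableOn_const hk.measure_lt_top.ne).add hE.integrableOn
  refine Integrable.mono' hb hm.restrict (Filter.Eventually.of_forall fun y => ?_)
  exact opNorm_le_one_add_sum_sq (Gw y)

/-! ## §2 The door -/

/-- ★★★ **BRICK (T) «CONE → PLANE TRANSPORT» — THE DOOR (px19 g8's DOOR-T text verbatim).**  A map of the vended minimising class on
the unit cube whose ball energies about the origin are linear (`E(U;B_r(0)) = Θ·r`, `0 < r ≤ 1∕2`) has a LINK `w : E² → S³` with weak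
gradient `Gw` on the whole plane: Sobolev (T-1), unit (T-2), of energy exactly `Θ` (T-3′), obeying the 2-d sphere conservation laws
(T-4). [cite: SchoenUhlenbeck1984, §1 (tangent maps; Prop. 1.2's link); Simon1996, §3.1] -/
theorem exists_link_of_linear_energies :
    ∀ (hQ : IsOpen {x : EuclideanSpace ℝ (Fin 3) | ∀ i : Fin 3, |x i| < 1}) (U : EuclideanSpace ℝ (Fin 3) → EuclideanSpace ℝ (Fin 4)) (G : EuclideanSpace ℝ (Fin 3) → (EuclideanSpace ℝ (Fin 3) →L[ℝ] EuclideanSpace ℝ (Fin 4))),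
      (HasWeakFDerivOn ⟨{x : EuclideanSpace ℝ (Fin 3) | ∀ i : Fin 3, |x i| < 1}, hQ⟩ volume U G ∧
        (∀ x : EuclideanSpace ℝ (Fin 3), (∀ i : Fin 3, |x i| < 1) → ‖U x‖ = 1) ∧
        IntegrableOn (fun x => ∑ i : Fin 3, ‖G x (EuclideanSpace.single i (1:ℝ))‖ ^ 2) {x : EuclideanSpace ℝ (Fin 3) | ∀ i : Fin 3, |x i| < 1} ∧
        (∀ (y : EuclideanSpace ℝ (Fin 3)) (ρ : ℝ), 0 < ρ → closedBall y ρ ⊆ {x : EuclideanSpace ℝ (Fin 3) | ∀ i : Fin 3, |x i| < 1} →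
          ∀ (W : EuclideanSpace ℝ (Fin 3) → EuclideanSpace ℝ (Fin 4)) (GW : EuclideanSpace ℝ (Fin 3) → (EuclideanSpace ℝ (Fin 3) →L[ℝ] EuclideanSpace ℝ (Fin 4))),
          HasWeakFDerivOn ⟨{x : EuclideanSpace ℝ (Fin 3) | ∀ i : Fin 3, |x i| < 1}, hQ⟩ volume W GW →
          (∀ x : EuclideanSpace ℝ (Fin 3), (∀ i : Fin 3, |x i| < 1) → ‖W x‖ = 1) →
          IntegrableOn (fun x => ∑ i : Fin 3, ‖GW x (EuclideanSpace.single i (1:ℝ))‖ ^ 2) {x : EuclideanSpace ℝ (Fin 3) | ∀ i : Fin 3, |x i| < 1} →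
          (∃ ρ' : ℝ, ρ' < ρ ∧ ∀ x : EuclideanSpace ℝ (Fin 3), x ∉ ball y ρ' → W x = U x) →
          ∫ x in ball y ρ, ∑ i : Fin 3, ‖G x (EuclideanSpace.single i (1:ℝ))‖ ^ 2 ≤ ∫ x in ball y ρ, ∑ i : Fin 3, ‖GW x (EuclideanSpace.single i (1:ℝ))‖ ^ 2)) →
      ∀ Θ : ℝ, (∀ r : ℝ, 0 < r → r ≤ 1 / 2 → ∫ x in ball (0 : EuclideanSpace ℝ (Fin 3)) r, ∑ i : Fin 3, ‖G x (EuclideanSpace.single i (1:ℝ))‖ ^ 2 = Θ * r) →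
      ∃ (w : EuclideanSpace ℝ (Fin 2) → EuclideanSpace ℝ (Fin 4)) (Gw : EuclideanSpace ℝ (Fin 2) → (EuclideanSpace ℝ (Fin 2) →L[ℝ] EuclideanSpace ℝ (Fin 4))),
        HasWeakFDerivOn ⟨Set.univ, isOpen_univ⟩ volume w Gw ∧ (∀ y, ‖w y‖ = 1) ∧
        Integrable (fun y => ∑ k : Fin 2, ‖Gw y (EuclideanSpace.single k (1:ℝ))‖ ^ 2) volume ∧
        (∫ y, ∑ k : Fin 2, ‖Gw y (EuclideanSpace.single k (1:ℝ))‖ ^ 2 = Θ) ∧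
        (∀ (p q : EuclideanSpace ℝ (Fin 4)), ‖p‖ = 1 → ‖q‖ = 1 → ⟪p, q⟫ = 0 →
          ∀ η : EuclideanSpace ℝ (Fin 2) → ℝ, ContDiff ℝ ∞ η → HasCompactSupport η →
            ∫ y, ∑ k : Fin 2, fderiv ℝ η y (EuclideanSpace.single k (1:ℝ)) *
              (⟪p, w y⟫ * ⟪Gw y (EuclideanSpace.single k (1:ℝ)), q⟫ - ⟪q, w y⟫ * ⟪Gw y (EuclideanSpace.single k (1:ℝ)), p⟫) = 0) := by
  intro hQ U G hUG Θ hlin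
  obtain ⟨hU, hU1, hGi, hmin⟩ := hUG
  -- the pinned symbols of the chart
  set c : EuclideanSpace ℝ (Fin 2) → ℝ := fun y => 2 / (1 + ‖y‖ ^ 2) with hcdef
  set σ : EuclideanSpace ℝ (Fin 2) → EuclideanSpace ℝ (Fin 3) := fun y => !₂[c y * y 0, c y * y 1, c y - 1] with hσdef
  set π : EuclideanSpace ℝ (Fin 3) → EuclideanSpace ℝ (Fin 2) := fun x => (‖x‖ + x 2)⁻¹ • !₂[x 0, x 1] with hπdef
  have hc : ∀ y, c y = 2 / (1 + ‖y‖ ^ 2) := fun _ => rfl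
  have hσ : ∀ y, σ y = !₂[c y * y 0, c y * y 1, c y - 1] := fun _ => rfl
  have hπ : ∀ x, π x = (‖x‖ + x 2)⁻¹ • !₂[x 0, x 1] := fun _ => rfl
  -- balls inside the cube
  have hB2 : closedBall (0 : EuclideanSpace ℝ (Fin 3)) (1/2) ⊆ {x : EuclideanSpace ℝ (Fin 3) | ∀ i : Fin 3, |x i| < 1} :=
    closedBall_subset_unitCube (by norm_num)
  have hB2' : ball (0 : EuclideanSpace ℝ (Fin 3)) (1/2) ⊆ {x : EuclideanSpace ℝ (Fin 3) | ∀ i : Fin 3, |x i| < 1} :=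
    ball_subset_closedBall.trans hB2
  have hB4 : ball (0 : EuclideanSpace ℝ (Fin 3)) (1/4) ⊆ {x : EuclideanSpace ℝ (Fin 3) | ∀ i : Fin 3, |x i| < 1} :=
    (ball_subset_ball (by norm_num)).trans hB2'
  have hB8 : closedBall (0 : EuclideanSpace ℝ (Fin 3)) (1/8) ⊆
      ((⟨{x : EuclideanSpace ℝ (Fin 3) | ∀ i : Fin 3, |x i| < 1}, hQ⟩ : Opens (EuclideanSpace ℝ (Fin 3))) : Set _) :=
    (closedBall_subset_closedBall (by norm_num)).trans hB2
  -- the weak gradient on the ball `B_{1/4}`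
  have hUB : HasWeakFDerivOn ⟨ball (0 : EuclideanSpace ℝ (Fin 3)) (1/4), isOpen_ball⟩ volume U G :=
    Literature.Analysis.FunctionSpaces.HasWeakFDerivOn.mono_set_holds hU (fun x hx => hB4 hx)
  -- radial constancy on `B_{1/4}` (px3 g9)
  have hrad : ∀ᵐ x ∂(volume.restrict (ball (0 : EuclideanSpace ℝ (Fin 3)) (1/4))), G x x = 0 := by
    have h := radialDeriv_ae_zero_of_ball_linear (Ω := ⟨{x : EuclideanSpace ℝ (Fin 3) | ∀ i : Fin 3, |x i| < 1}, hQ⟩) hU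
      (fun x hx => hU1 x hx) hGi (y := 0) (R := 1/2) (by norm_num) hB2'
      (fun W GW hW hW1 hWi hWU => hmin 0 (1/2) (by norm_num) hB2 W GW hW (fun x hx => hW1 x hx) hWi hWU) (Θ := Θ) hlin
    rw [show (1/2 : ℝ) / 2 = 1/4 by norm_num] at h
    filter_upwards [h] with x hx
    have h2 : (∑ i : Fin 3, (x i - (0 : EuclideanSpace ℝ (Fin 3)) i) • G x (EuclideanSpace.single i (1:ℝ))) = G x x := by
      have h3 := congrArg (G x) (sum_apply_smul_single x)
      rw [map_sum] at h3
      simpa only [PiLp.zero_apply, sub_zero, map_smul] using h3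
    rw [← h2, hx]
  -- the good slice and the link
  obtain ⟨t₀, ht₀, hwm, hGwm, hVw, hHw⟩ := exists_goodSlice_link hc hσ hUB hrad
  have hradS := ae_slab_weakGrad_sigma_eq_zero hc hσ hrad
  -- (T-2): unit everywhere (`t₀ • σ y ∈ B_{1/4}(0) ⊆ Q`)
  have hunit : ∀ y : EuclideanSpace ℝ (Fin 2), ‖U (t₀ • σ y)‖ = 1 := fun y =>
    hU1 _ (hB4 (by rw [mem_ball_zero_iff, norm_smul_sigma hc hσ, abs_of_pos ht₀.1]; exact ht₀.2))
  -- (T-3′): energy through the chart (px16 g10), at `E(B_{1/4}) = Θ/4`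
  have hE := integrable_and_integral_linkEnergy hc hσ
    (Gw := fun y => (G (t₀ • σ y)).comp (t₀ • fderiv ℝ σ y)) hHw hradS (hGi.mono_set hB4) Θ
    (hlin (1/4) (by norm_num) (by norm_num))
  -- (T-1): the link is Sobolev (FILE D4), `Ω = Q ⊇ B̄_{1/8}`
  have hT1 := hasWeakFDerivOn_link hc hσ hπ hB8 hU (w := fun y => U (t₀ • σ y))
    (Gw := fun y => (G (t₀ • σ y)).comp (t₀ • fderiv ℝ σ y))
    (locallyIntegrable_of_norm_le hwm (fun y => (hunit y).le))
    (locallyIntegrable_of_energy hGwm hE.1) hVw hHw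
  -- (T-4): currents through the chart (px19 g8), fed with w7 g14's laws on `B_{1/2}(0)`
  have hT4 := currents_through_chart hc hσ hπ (w := fun y => U (t₀ • σ y))
    (Gw := fun y => (G (t₀ • σ y)).comp (t₀ • fderiv ℝ σ y)) hVw hHw hradS fun p q hp hq hpq ζ hζ hζs =>
    weaklyHarmonic_of_cubeMinimiser hQ ⟨hU, hU1, hGi, hmin⟩ (y := 0) (ρ := 1/2) (ρ' := 1/4) (by norm_num) hB2
      (by norm_num) hp hq hpq hζ hζs
  exact ⟨fun y => U (t₀ • σ y), fun y => (G (t₀ • σ y)).comp (t₀ • fderiv ℝ σ y), hT1, hunit, hE.1, hE.2, hT4⟩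

end Summit.QuantumFields.YangMills.Theorems.PoincareLipschitzConeLinkTransport

end
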